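import Summits.AtomisticToContinuum.HydrodynamicLimit.Theorems.JaynesSqueezeHardSphereLDA
import Summits.AtomisticToContinuum.HydrodynamicLimit.Theorems.ImplosionDichotomyHsEosLowDensity
import HarnessLib

/-!
# `JaynesSqueeze.BlockGibbs` reduced to the route's open cruxes (support for stmt-AtomisticToContinuum-13462)

The typed waypoint `BlockGibbs` (block local Gibbsianity in specific relative entropy of the evolved
local Gibbs law of deterministic hard spheres, block-constant reference in a compact parameter range)
is not a hypothesis of the route's deciding theorem `JaynesSqueeze.closes`: inside the route it is the
conclusion of the squeeze `SqueezeToBlockGibbs : NoMeanEntropyProduction → MeanBlocksInRange →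
HardSphereLDA → HsEosLowDensity → DiluteSelfConsistency → BlockGibbs`. Two of the five antecedents are
theorems of the tree — the static local density approximation `hardSphereLDA_proof`
(stmt-AtomisticToContinuum-13459) and the low-density equation of state `hsEosLowDensity_proof`
(stmt-AtomisticToContinuum-0768; the `ImplosionDichotomy` and `JaynesSqueeze` copies of
`HsEosLowDensity` are the same proposition, cf. the route file's `HsEosLowDensity_holds`) — so
`BlockGibbs` follows from the three OPEN dynamical cruxes `NoMeanEntropyProduction` (K1, stmt-13437),
`MeanBlocksInRange` (R, stmt-13458), `DiluteSelfConsistency` (D, stmt-3091) and the squeeze item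
(stmt-13463) alone (`blockGibbs_of_cruxes`). This records in the tree the exact closing term of the
waypoint; no dynamical content is proved here (the positive-time statement is Yau's local-equilibrium
problem for deterministic hard spheres; the `s = 0` and constant-data cases are
`BlockGibbsLine.blockGibbs_of_eq_zero` / `blockGibbs_of_const`).
-/

namespace Summit.AtomisticToContinuum.HydrodynamicLimit.Theorems.BlockGibbsLine

open Summit.AtomisticToContinuum.HydrodynamicLimit.Theses.JaynesSqueeze

/-- **`BlockGibbs` from the open cruxes.** With the statics discharged (`hardSphereLDA_proof`,
`hsEosLowDensity_proof`), the squeeze item turns no-mean-entropy-production (K1), the a-priori range of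
the mean block fields (R) and dilute self-consistency (D) into block local Gibbsianity: the waypoint
`BlockGibbs` is `SqueezeToBlockGibbs` applied to K1, R, D. [cite: Yau1991, §2] -/
theorem blockGibbs_of_cruxes (h₁ : NoMeanEntropyProduction) (h₄ : MeanBlocksInRange)
    (h₅ : DiluteSelfConsistency) (hS : SqueezeToBlockGibbs) : BlockGibbs :=
  hS h₁ h₄ hardSphereLDA_proof
    _root_.Summit.AtomisticToContinuum.HydrodynamicLimit.Theorems.hsEosLowDensity_proof h₅

end Summit.AtomisticToContinuum.HydrodynamicLimit.Theorems.BlockGibbsLine
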